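import Summits.HodgeConjecture.CorCM.MultiFieldWeilTwoSimpleThreefolds
import Summits.HodgeConjecture.CorCM.MultiFieldWeilNonIsomorphicGroupBlocks
import HarnessLib

/-!
# MULTI-FIELD WEIL ENGINE — THE PAIR BLOCK: two simple CM threefolds whose sextic CM fields contain one imaginary quadratic field `k` (e.g. TWO TYPES OF ONE FIELD `k·F⁺`),
# together with any CM elliptic curves through `k`, inside a uniform family — the Hodge conjecture for every product of copies, given ONLY Markman's fourfold theorem

Cell `pub-hodgecm2` (COR-CM), seat b30 gen 37 (2026-08-25); count-neutral own lane MULTI-FIELD WEIL ENGINE (stem `MultiFieldWeil*`).  Theorems only; no definition, no named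
fact, no `sorry`.  HONEST FRAMING: conditional ONLY on `Markman2025_weilClasses_algebraic_abelianFourfold`; `HC_CM` is NOT proved and not asserted.

The family form of gen 31's assembly `hodgeConjectureFor_biproduct_comp_vec_of_two_simpleThreefolds_of_markman` (`CorCM/MultiFieldWeilTwoSimpleThreefolds.lean`: `E ⊨ (k; Ψ)`,
`T₀ ⊨ (K₀; Φ₀)`, `T₁ ⊨ (K₁; Φ₁)` ANY two simple CM threefolds with `k ↪ K₀`, `k ↪ K₁` — non-isomorphic fields ∕ one field two types ∕ isogenous —: HC for every `E^a × T₀^b × T₁^c`),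
in the pattern of the group block `hodgeConjectureFor_prod_groupBlock_of_outside_closures` (`CorCM/MultiFieldWeilNonIsomorphicGroupBlocks.lean` §1):
**`hodgeConjectureFor_prod_pairBlock_of_markman`** — in a uniform family `A_i ⊨ (K_i; Φ_i)` of simple CM abelian varieties, two SEXTIC slots `t, t′` whose fields receive the
imaginary quadratic field `k`, and a product of copies every member of which is `A_t`, `A_{t′}` or a CM elliptic curve whose field embeds in `K_t` or `K_{t′}` (hence is `≅ k`: a
sextic field has one quadratic subfield; such a curve is isogenous to the CM curve `E ⊨ (k; {τ})`): the Hodge conjecture holds for it, mod Markman 4 (the product is isogenous to a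
product of copies of `![E, A_t, A_{t′}]`).  PURPOSE: the block of an ISOLATED has-k field carrying TWO isogeny classes of threefolds in the classes-per-field family theorem
(`CorCM/MultiFieldWeilTwoPerIsolatedFieldFamilies.lean`).

[cite: Markman2025SurveySecant, Thm. 1.2] [cite: Shimura1998, §6.1 Corollary of Theorem 2 (p. 41), §8.2 Prop. 26, §18.2 Lemma (i)] [cite: MoonenZarhin1999LowDim, Thm. (0.1)]
[cite: Lang2002, VI §1 Thm. 1.1 and Cor. 1.6] [cite: MumfordAV1970, §19 Thm. 1 and p. 169]

## References
* [Markman2025SurveySecant] E. Markman, arXiv:2509.23403, Thm. 1.2.  [Shimura1998] G. Shimura, *Abelian varieties with complex multiplication and modular functions*, §6.1,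
  §8.2, §18.2.  [MoonenZarhin1999LowDim] B. Moonen, Yu. Zarhin, Math. Ann. 315 (1999).  [Lang2002] S. Lang, *Algebra*, VI §1.  [MumfordAV1970] D. Mumford, *Abelian Varieties*, §19.
-/

noncomputable section

open CategoryTheory CategoryTheory.Limits NumberField IntermediateField

namespace Summit.HodgeConjecture.CorCM.MultiFieldWeil

open Literature.AlgebraicGeometry Literature.AlgebraicGeometry.Motives Literature.AlgebraicGeometry.HodgeTheory
open Literature.AlgebraicGeometry.ComplexMultiplication (IsCMTypeRealisation)
open Literature.AlgebraicTopology.SingularHomology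
open Literature.NumberTheory.ComplexMultiplication

open scoped Classical

section PairBlock

variable {I : Type} {K : I → Type} [∀ i, Field (K i)] [∀ i, NumberField (K i)] [∀ i, IsCMField (K i)]
  {Φ : ∀ i, CMType (K i)} {A : I → AbelianVariety ℂ} {ι : ∀ i, 𝓞 (K i) →+* End (A i)} {θ : ∀ i, K i →+* Module.End ℂ (complexBetti (A i).X 1)}

/-- **THE PAIR BLOCK.**  `A_i ⊨ (K_i; Φ_i)` simple; `t, t′` SEXTIC slots whose fields receive the imaginary quadratic field `k` (`i : k ↪ K_t`, `i′ : k ↪ K_{t′}`; the fields may be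
isomorphic — two types of one field —, the slots may even carry isogenous varieties); a product of copies `⨁_l A_{ρ l}` every member of which is `A_t`, `A_{t′}` or a CM elliptic curve
whose field embeds in `K_t` or in `K_{t′}`.  Then the Hodge conjecture holds for it, GIVEN ONLY Markman's fourfold theorem: every such curve is isogenous to the CM elliptic curve
`E ⊨ (k; {τ})` (a sextic field has one quadratic subfield), so the product is isogenous to a product of copies of `![E, A_t, A_{t′}]`, settled by
`hodgeConjectureFor_biproduct_comp_vec_of_two_simpleThreefolds_of_markman`.  `HC_CM` is NOT asserted. [cite: Markman2025SurveySecant, Thm. 1.2]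
[cite: Shimura1998, §6.1 Corollary of Theorem 2, §18.2 Lemma (i)] [cite: MumfordAV1970, §19 Thm. 1 and p. 169] -/
theorem hodgeConjectureFor_prod_pairBlock_of_markman (hW4 : Markman2025_weilClasses_algebraic_abelianFourfold)
    (hA : ∀ i, IsCMTypeRealisation (Φ i) (A i) (ι i) (θ i)) (hS : ∀ i, (A i).IsSimple) (t t' : I) (h6 : Module.finrank ℚ (K t) = 6) (h6' : Module.finrank ℚ (K t') = 6)
    {k : Type} [Field k] [NumberField k] [IsCMField k] (h2 : Module.finrank ℚ k = 2) (i : k →+* K t) (i' : k →+* K t')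
    {M : ℕ} (ρ : Fin M → I)
    (hρ : ∀ l, (Module.finrank ℚ (K (ρ l)) = 2 ∧ (Nonempty (K (ρ l) →+* K t) ∨ Nonempty (K (ρ l) →+* K t'))) ∨ ρ l = t ∨ ρ l = t') :
    HodgeConjectureFor (⨁ fun l => A (ρ l)).dim (⨁ fun l => A (ρ l)).X := by
  -- the CM elliptic curve of `k`
  obtain ⟨τ⟩ : Nonempty (k →+* ℂ) := inferInstance
  obtain ⟨Ψ, E, ιE, θE, hE, -⟩ := exists_cmCurve_iff_eq h2 τ
  -- every curve member is isogenous to `E`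
  have hcurve : ∀ l, (Module.finrank ℚ (K (ρ l)) = 2 ∧ (Nonempty (K (ρ l) →+* K t) ∨ Nonempty (K (ρ l) →+* K t'))) →
      AbelianVariety.IsIsogenous (A (ρ l)) E := by
    rintro l ⟨h2l, hg | hg⟩ <;> obtain ⟨g⟩ := hg
    · obtain ⟨φ⟩ := WeilFibre.nonempty_algEquiv_of_finrank_eq_two (M := K t) h2l h2 (by rw [h6]; decide) g.toRatAlgHom i.toRatAlgHom
      exact isIsogenous_of_ringEquiv h2l (hA (ρ l)) hE φ.symm.toRingEquiv
    · obtain ⟨φ⟩ := WeilFibre.nonempty_algEquiv_of_finrank_eq_two (M := K t') h2l h2 (by rw [h6']; decide) g.toRatAlgHom i'.toRatAlgHom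
      exact isIsogenous_of_ringEquiv h2l (hA (ρ l)) hE φ.symm.toRingEquiv
  -- the slot map into `![E, A t, A t']`
  let V : Fin 3 → AbelianVariety ℂ := ![E, A t, A t']
  let σ : I → Fin 3 := fun x => if x = t then 1 else if x = t' then 2 else 0
  have hσ : ∀ l, AbelianVariety.IsIsogenous (A (ρ l)) (V (σ (ρ l))) := by
    intro l
    by_cases ht : ρ l = t
    · have hs : σ (ρ l) = 1 := by simp only [σ, if_pos ht]
      rw [hs, ht]
      exact AbelianVariety.IsIsogenous.refl _
    by_cases ht' : ρ l = t'
    · have hs : σ (ρ l) = 2 := by simp only [σ, if_neg ht, if_pos ht']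
      rw [hs, ht']
      exact AbelianVariety.IsIsogenous.refl _
    have hs : σ (ρ l) = 0 := by simp only [σ, if_neg ht, if_neg ht']
    rw [hs]
    exact hcurve l ((hρ l).resolve_right fun h => h.elim ht ht')
  have hiso : AbelianVariety.IsIsogenous (⨁ fun l => A (ρ l)) (⨁ fun l => V (σ (ρ l))) := AbelianVariety.IsIsogenous.biproduct hσ
  refine Domination.hodgeConjectureFor_of_avDominatedBy ?_ (Domination.AVDominatedBy.of_isIsogenous hiso (Domination.AVDominatedBy.refl _))
  exact hodgeConjectureFor_biproduct_comp_vec_of_two_simpleThreefolds_of_markman hW4 h2 h6 h6' i i' hE (hA t) (hA t') (hS t) (hS t') fun l => σ (ρ l)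

/-- **Dominated form of the pair block.** [cite: Markman2025SurveySecant, Thm. 1.2] [cite: MumfordAV1970, §19 Thm. 1 and p. 169] -/
theorem hodgeConjectureFor_of_avDominatedBy_prod_pairBlock_of_markman (hW4 : Markman2025_weilClasses_algebraic_abelianFourfold)
    (hA : ∀ i, IsCMTypeRealisation (Φ i) (A i) (ι i) (θ i)) (hS : ∀ i, (A i).IsSimple) (t t' : I) (h6 : Module.finrank ℚ (K t) = 6) (h6' : Module.finrank ℚ (K t') = 6)
    {k : Type} [Field k] [NumberField k] [IsCMField k] (h2 : Module.finrank ℚ k = 2) (i : k →+* K t) (i' : k →+* K t')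
    {M : ℕ} (ρ : Fin M → I)
    (hρ : ∀ l, (Module.finrank ℚ (K (ρ l)) = 2 ∧ (Nonempty (K (ρ l) →+* K t) ∨ Nonempty (K (ρ l) →+* K t'))) ∨ ρ l = t ∨ ρ l = t')
    {X : AbelianVariety ℂ} (hX : Domination.AVDominatedBy X (⨁ fun l => A (ρ l))) : HodgeConjectureFor X.dim X.X :=
  Domination.hodgeConjectureFor_of_avDominatedBy (hodgeConjectureFor_prod_pairBlock_of_markman hW4 hA hS t t' h6 h6' h2 i i' ρ hρ) hX

end PairBlock

end Summit.HodgeConjecture.CorCM.MultiFieldWeil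

end
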